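import Mathlib
import Literature.NumberTheory.EllipticCurves.Zywina2025RankTwo
import Literature.NumberTheory.Sieve.PolynomialProgressionsInPrimes
import HarnessLib

/-!
# Zywina 2025 — infinitely many admissible pairs, from Tao–Ziegler (§4 of the paper)

D. Zywina, *There are infinitely many elliptic curves over the rationals of rank 2*,
arXiv:2502.01957 (2025), §4 (proof of Theorem 1.1, first paragraph, p. 10):

> "The set of primes that are congruent to `11` modulo `24` has natural density `1/φ(24) = 1/8`. By
> [TZ, Theorem 1.3], there are infinitely many pairs `(m, n)` of natural numbers for which `m`,
> `m + 16n²` and `m + 25n²` are primes congruent to `11` modulo `24`."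

The tree file `Zywina2025RankTwo.lean` records this as the NAMED FACT `zywinaSet_infinite`. Here it
is DERIVED from the general named fact `Literature.NumberTheory.Sieve.TaoZiegler2008_polynomialProgressions`
(Tao–Ziegler 2008 Thm 1.3, as printed) and the tree's (proved) prime number theorem in arithmetic
progressions, exactly as in the quoted paragraph — and in the stronger RESIDUE-CLASS form obtained by
running the same argument with `A = {ℓ prime : ℓ ≡ m₁ (mod 24·L)}` and the pattern
`(x, x + 16(12 d y)², x + 25(12 d y)²)`:

* `infinite_setOf_zywinaAdmissible_modEq_dvd` — for `L, d ≥ 1`, `m₁ ≡ 11 (mod 24)`, `(m₁, L) = 1`: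
  infinitely many admissible `(m, n)` with `m ≡ m₁ (mod L)` and `d ∣ n`;
* `zywinaClass p K m₁ M = {(m, n) admissible : m ≡ m₁ (mod p^K), p^K M ∣ n}` and
  `zywinaClass_infinite` (`p` prime, `p ∤ m₁`, `m₁ ≡ 11 (mod 24)`, `M ≥ 1`);
* `zywinaSet_infinite_of_taoZiegler : TaoZiegler2008_polynomialProgressions → zywinaSet_infinite`
  (the tree's fact is the class `K = 0`, `M = 1`).

Everything here is PROVED modulo the single named fact `TaoZiegler2008_polynomialProgressions`; no
new fact is introduced. Not here: any statement about the curves `E_{m,n}` beyond what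
`Zywina2025RankTwo.lean` proves (rank `2`, Selmer groups, `Ш[2] = 0`, …), which transfer to every
class verbatim since `zywinaClass p K m₁ M ⊆ zywinaSet`.
-/

open Polynomial

namespace Literature.NumberTheory.EllipticCurves.Zywina2025

open Literature.NumberTheory.Sieve

/-! ### Residue classes of the admissible set -/

/-- The residue class `C(p, K, m₁, M) = {(m, n) admissible : m ≡ m₁ (mod p^K), p^K·M ∣ n}` of
Zywina's admissible set (`ZywinaAdmissible`: `n ≥ 1`; `m`, `m + 16n²`, `m + 25n²` primes
`≡ 11 (mod 24)`). [cite: Zywina2025, Thm 1.2 and §4] -/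
def zywinaClass (p K m₁ M : ℕ) : Set (ℕ × ℕ) :=
  {mn | ZywinaAdmissible mn.1 mn.2 ∧ mn.1 ≡ m₁ [MOD p ^ K] ∧ p ^ K * M ∣ mn.2}

/-- Membership in a class, unfolded. [cite: Zywina2025, Thm 1.2 and §4] -/
theorem mem_zywinaClass {p K m₁ M : ℕ} {mn : ℕ × ℕ} :
    mn ∈ zywinaClass p K m₁ M ↔
      ZywinaAdmissible mn.1 mn.2 ∧ mn.1 ≡ m₁ [MOD p ^ K] ∧ p ^ K * M ∣ mn.2 :=
  Iff.rfl

/-- Every class lies in the admissible set. [cite: Zywina2025, Thm 1.2 and §4] -/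
theorem zywinaClass_subset (p K m₁ M : ℕ) : zywinaClass p K m₁ M ⊆ zywinaSet :=
  fun _ h => h.1

/-- The class `K = 0`, `M = 1` is the whole admissible set. [cite: Zywina2025, Thm 1.2 and §4] -/
theorem zywinaClass_zero_one (p m₁ : ℕ) : zywinaClass p 0 m₁ 1 = zywinaSet := by
  ext mn
  simp only [zywinaClass, zywinaSet, pow_zero, Nat.ModEq, Nat.mod_one, mul_one, one_dvd, and_true,
    Set.mem_setOf_eq]

/-! ### The Tao–Ziegler argument of §4, in residue classes -/

/-- `m₁ ≡ 11 (mod 24)` gives `(m₁, 24) = 1`. [folklore] -/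
private theorem coprime_twentyFour_of_mod {m₁ : ℕ} (hm₁ : m₁ % 24 = 11) : m₁.Coprime 24 := by
  rw [Nat.Coprime, Nat.gcd_comm, Nat.gcd_rec, hm₁]
  norm_num

/-- The pattern `(0, 16(12d)² y², 25(12d)² y²)` as integer polynomials vanishing at `0`. [folklore] -/
private noncomputable def zywinaPattern (d : ℕ) : Fin 3 → ℤ[X] :=
  ![0, C (16 * (12 * (d : ℤ)) ^ 2) * X ^ 2, C (25 * (12 * (d : ℤ)) ^ 2) * X ^ 2]

/-- The pattern vanishes at `0`. [folklore] -/
private theorem zywinaPattern_eval_zero (d : ℕ) (i : Fin 3) : (zywinaPattern d i).eval 0 = 0 := by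
  fin_cases i <;> simp [zywinaPattern]

/-- First entry of the pattern: `0`. [folklore] -/
private theorem zywinaPattern_eval_zero' (d : ℕ) (y : ℤ) : (zywinaPattern d 0).eval y = 0 := by
  simp [zywinaPattern]

/-- Second entry of the pattern: `16(12 d y)²`. [folklore] -/
private theorem zywinaPattern_eval_one (d : ℕ) (y : ℤ) :
    (zywinaPattern d 1).eval y = 16 * (12 * (d : ℤ) * y) ^ 2 := by
  simp [zywinaPattern]; ring

/-- Third entry of the pattern: `25(12 d y)²`. [folklore] -/
private theorem zywinaPattern_eval_two (d : ℕ) (y : ℤ) :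
    (zywinaPattern d 2).eval y = 25 * (12 * (d : ℤ) * y) ^ 2 := by
  simp [zywinaPattern]; ring

/-- **Zywina 2025 §4 in residue classes** (Tao–Ziegler Thm 1.3 with
`A = {ℓ prime : ℓ ≡ m₁ (mod 24 L)}` — relative density `1/φ(24L) > 0` by the prime number theorem in
arithmetic progressions — and the pattern `x, x + 16(12 d y)², x + 25(12 d y)²`): for `L, d ≥ 1`,
`m₁ ≡ 11 (mod 24)` and `(m₁, L) = 1` there are infinitely many admissible pairs `(m, n)` with
`m ≡ m₁ (mod L)` and `d ∣ n`. PROVED modulo the named fact `TaoZiegler2008_polynomialProgressions`.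
[cite: Zywina2025, §4 (proof of Thm 1.1, first paragraph)] -/
theorem infinite_setOf_zywinaAdmissible_modEq_dvd (hTZ : TaoZiegler2008_polynomialProgressions)
    {L d m₁ : ℕ} (hL : 0 < L) (hd : 0 < d) (hm₁ : m₁ % 24 = 11) (hcop : m₁.Coprime L) :
    {mn : ℕ × ℕ | ZywinaAdmissible mn.1 mn.2 ∧ mn.1 ≡ m₁ [MOD L] ∧ d ∣ mn.2}.Infinite := by
  have hq : 24 * L ≠ 0 := by positivity
  have hcop' : m₁.Coprime (24 * L) := Nat.Coprime.mul_right (coprime_twentyFour_of_mod hm₁) hcop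
  have hS := hTZ.prime_modEq hq hcop' (zywinaPattern d) (zywinaPattern_eval_zero d)
  -- the map `(x, y) ↦ (x, 12 d y)` from Tao–Ziegler pairs to admissible pairs
  refine Set.infinite_of_injOn_mapsTo (f := fun xm : ℤ × ℤ => (xm.1.toNat, 12 * d * xm.2.toNat))
    ?_ ?_ hS
  · -- injective on the Tao–Ziegler set (`x = a prime ≥ 0`, `y > 0`)
    rintro ⟨x, y⟩ ⟨hy, hall⟩ ⟨x', y'⟩ ⟨hy', hall'⟩ h
    dsimp only at hy hall hy' hall' h
    obtain ⟨p, -, hp⟩ := hall 0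
    obtain ⟨p', -, hp'⟩ := hall' 0
    rw [zywinaPattern_eval_zero', add_zero] at hp hp'
    subst hp hp'
    obtain ⟨k, rfl⟩ := Int.eq_ofNat_of_zero_le hy.le
    obtain ⟨k', rfl⟩ := Int.eq_ofNat_of_zero_le hy'.le
    simp only [Int.toNat_natCast, Prod.mk.injEq] at h
    obtain ⟨rfl, h2⟩ := h
    obtain rfl : k = k' := Nat.eq_of_mul_eq_mul_left (by positivity : 0 < 12 * d) h2
    rfl
  · -- lands in the class
    rintro ⟨x, y⟩ ⟨hy, hall⟩
    dsimp only at hy hall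
    obtain ⟨p, ⟨hp, hpmod⟩, hpx⟩ := hall 0
    obtain ⟨q, ⟨hqp, hqmod⟩, hqx⟩ := hall 1
    obtain ⟨r, ⟨hrp, hrmod⟩, hrx⟩ := hall 2
    rw [zywinaPattern_eval_zero', add_zero] at hpx
    subst hpx
    obtain ⟨k, rfl⟩ := Int.eq_ofNat_of_zero_le hy.le
    rw [zywinaPattern_eval_one] at hqx
    rw [zywinaPattern_eval_two] at hrx
    have hk : 0 < k := by exact_mod_cast hy
    have hq_eq : p + 16 * (12 * d * k) ^ 2 = q := by
      have : ((p + 16 * (12 * d * k) ^ 2 : ℕ) : ℤ) = q := by push_cast; rw [hqx]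
      exact_mod_cast this
    have hr_eq : p + 25 * (12 * d * k) ^ 2 = r := by
      have : ((p + 25 * (12 * d * k) ^ 2 : ℕ) : ℤ) = r := by push_cast; rw [hrx]
      exact_mod_cast this
    have hmod24 : ∀ {ℓ : ℕ}, ℓ ≡ m₁ [MOD 24 * L] → ℓ % 24 = 11 := fun {ℓ} h => by
      have h' : ℓ % 24 = m₁ % 24 := Nat.ModEq.of_mul_right L h
      omega
    simp only [Set.mem_setOf_eq, Int.toNat_natCast]
    refine ⟨⟨by positivity, hp, ?_, ?_, hmod24 hpmod, ?_, ?_⟩, Nat.ModEq.of_mul_left 24 hpmod,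
      ⟨12 * k, by ring⟩⟩
    · rw [hq_eq]; exact hqp
    · rw [hr_eq]; exact hrp
    · rw [hq_eq]; exact hmod24 hqmod
    · rw [hr_eq]; exact hmod24 hrmod

/-- **The residue classes are infinite**: for `p` prime, `p ∤ m₁`, `m₁ ≡ 11 (mod 24)`, `M ≥ 1`, the
class `zywinaClass p K m₁ M` is infinite (Tao–Ziegler with `A = {ℓ ≡ m₁ (mod 24 p^K)}` and
`n = 12 p^K M y`). PROVED modulo `TaoZiegler2008_polynomialProgressions`.
[cite: Zywina2025, §4 (proof of Thm 1.1, first paragraph)] -/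
theorem zywinaClass_infinite (hTZ : TaoZiegler2008_polynomialProgressions) {p K m₁ M : ℕ}
    (hp : p.Prime) (hm₁ : m₁ % 24 = 11) (hpm : ¬ p ∣ m₁) (hM : 0 < M) :
    (zywinaClass p K m₁ M).Infinite := by
  have hpK : 0 < p ^ K := pow_pos hp.pos K
  have hcop : m₁.Coprime (p ^ K) :=
    Nat.Coprime.pow_right K ((Nat.Prime.coprime_iff_not_dvd hp).mpr hpm).symm
  exact infinite_setOf_zywinaAdmissible_modEq_dvd hTZ hpK (mul_pos hpK hM) hm₁ hcop

/-- The same, with the quantifiers outermost (the shape in which a consumer states the input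
"Tao–Ziegler reaches every residue class"). PROVED modulo `TaoZiegler2008_polynomialProgressions`.
[cite: Zywina2025, §4 (proof of Thm 1.1, first paragraph)] -/
theorem forall_zywinaClass_infinite (hTZ : TaoZiegler2008_polynomialProgressions) :
    ∀ p K m₁ M : ℕ, p.Prime → m₁ % 24 = 11 → ¬ p ∣ m₁ → 0 < M →
      (zywinaClass p K m₁ M).Infinite :=
  fun _ _ _ _ hp hm₁ hpm hM => zywinaClass_infinite hTZ hp hm₁ hpm hM

/-- **Zywina 2025 §4, first paragraph, DERIVED**: the tree's named fact `zywinaSet_infinite`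
(infinitely many admissible pairs `(m, n)`) follows from Tao–Ziegler 2008 Thm 1.3 and the prime
number theorem in arithmetic progressions (`A = {ℓ ≡ 11 (mod 24)}`, pattern `(0, 16(12y)², 25(12y)²)`).
[cite: Zywina2025, §4 (proof of Thm 1.1, first paragraph)] -/
theorem zywinaSet_infinite_of_taoZiegler (hTZ : TaoZiegler2008_polynomialProgressions) :
    zywinaSet_infinite := by
  have h := zywinaClass_infinite hTZ (p := 5) (K := 0) (m₁ := 11) (M := 1)
    (by norm_num) (by norm_num) (by norm_num) one_pos
  rwa [zywinaClass_zero_one] at h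

/-- **Zywina 2025, Theorem 1.1 modulo Tao–Ziegler**: infinitely many `j`-invariants of rank-`2`
elliptic curves over `ℚ` (the tree's `infinite_setOf_j_mordellWeilRank_eq_two`, whose only input
`zywinaSet_infinite` is now supplied by `TaoZiegler2008_polynomialProgressions`).
[cite: Zywina2025, Thm 1.1] -/
theorem infinite_setOf_j_mordellWeilRank_eq_two_of_taoZiegler
    (hTZ : TaoZiegler2008_polynomialProgressions) :
    {j : ℚ | ∃ (W : WeierstrassCurve ℚ) (hW : W.IsElliptic),
      @WeierstrassCurve.j _ _ W hW = j ∧ W.mordellWeilRank = 2}.Infinite :=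
  infinite_setOf_j_mordellWeilRank_eq_two (zywinaSet_infinite_of_taoZiegler hTZ)

end Literature.NumberTheory.EllipticCurves.Zywina2025
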